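import Summits.KontsevichZagierPeriods.KontsevichZagierPeriods.Theorems.SoloInformedFlatTorsion
import Summits.KontsevichZagierPeriods.KontsevichZagierPeriods.Statement
import Literature.NumberTheory.Transcendental.KZKernelConjectureForms
import HarnessLib
import HarnessLib.Audit

/-!
# SoloInformed — the flat Kontsevich–Zagier conjecture and the equal-dimension reduction of the summit (Newton–Leibniz elimination, file 1b-E)

Solo programme `solo-KontsevichZagierPeriods-informed`, session s245 (K-NF file 1b-E of the
kernel programme of THEOREM NF, `paper/nl-elimination.md` §7–§8).

Two consequences of the flattening calculus (files 583–587) for the SUMMIT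
`KontsevichZagierPeriods` itself.

1. **Equal-dimension reduction (unconditional).** Since `r × [0,1]^k` is equivalent to `r`, keeps
   the value and keeps KZ's literal shape (rational integrand over a `ℚ`-semialgebraic domain,
   `soloInformed_isRational_flatIter`), Conjecture 1 for ALL pairs of representations is
   equivalent to Conjecture 1 for pairs of representations OF THE SAME DIMENSION
   (`soloInformed_kzp_iff_sameDim`).

2. **The flat KZ conjecture.** `SoloInformedFlatKZConjecture`: every formal `ℤ`-combination of
   integral representations with value `0` is generated by the equidimensional moves (1a), (1b),
   (2) and the flattening differences `[r × [0,1]] − [r]` — a form of the period conjecture with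
   NO Newton–Leibniz / Stokes rule.  Unconditionally
   `SoloInformedFlatKZConjecture ↔ KontsevichZagierPeriods ∧ SoloInformedNLElimination`
   (`soloInformed_flatKZConjecture_iff_summit`) and, by the torsion theorem of file 586,
   `SoloInformedFlatKZConjecture ↔ ∀ c, eval c = 0 → Φ_N c ∈ relations₁₂ for N ≫ 0`
   (`soloInformed_flatKZConjecture_iff_totalFlat`): **granting THEOREM NF the summit is the
   statement that a null formal combination, totally flattened to any large common dimension, is
   an equidimensional relation** (`soloInformed_summit_iff_totalFlat_of_nlElimination`) — the
   representation-level form of "KZP ⟺ STABLE generalised Hilbert-third-problem statement"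
   (`paper/VERDICT.md` §1, `paper/nl-elimination.md` COROLLARY NF.2).

References: M. Kontsevich, D. Zagier, *Periods* (2001), §1.1–§1.2, Conjecture 1; this work
(THEOREM NF, `paper/nl-elimination.md`).
-/

noncomputable section

open scoped BigOperators

namespace Summit.KontsevichZagierPeriods.KontsevichZagierPeriods.Theorems

open Set MeasureTheory
open Literature.ModelTheory.ExponentialFields
open Literature.NumberTheory.Transcendental Literature.NumberTheory.Transcendental.KZ

variable {n m l k : ℕ}

/-! ### Flattening preserves KZ's literal shape -/

/-- **`r × [0,1]` has KZ's literal shape if `r` does**: the integrand of `flat r` is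
`(p/q) ∘ init = rename castSucc p / rename castSucc q` on the band. [Kontsevich–Zagier 2001, §1.1] -/
theorem soloInformed_isRational_flat {r : IntegralRep n} (hr : r.IsRational) :
    (soloInformedFlat r).IsRational := by
  obtain ⟨p, q, hq, hpq⟩ := hr
  refine ⟨MvPolynomial.rename Fin.castSucc p, MvPolynomial.rename Fin.castSucc q, ?_, ?_⟩
  · intro z hz
    rw [soloInformed_flat_domain] at hz
    rw [MvPolynomial.aeval_rename]
    exact hq _ hz.1
  · intro z hz
    rw [soloInformed_flat_domain] at hz
    have hz' : Fin.snoc (Fin.init z) (z (Fin.last n)) = z := Fin.snoc_init_self z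
    have hint : (soloInformedFlat r).integrand z = r.integrand (Fin.init z) := by
      conv_lhs => rw [← hz']
      rw [soloInformed_flat_integrand_snoc]
    show (soloInformedFlat r).integrand z =
      MvPolynomial.aeval z (MvPolynomial.rename Fin.castSucc p) /
        MvPolynomial.aeval z (MvPolynomial.rename Fin.castSucc q)
    rw [hint, MvPolynomial.aeval_rename, MvPolynomial.aeval_rename]
    exact hpq hz.1

/-- `r × [0,1]^k` has KZ's literal shape if `r` does. [Kontsevich–Zagier 2001, §1.1] -/
theorem soloInformed_isRational_flatIter {r : IntegralRep n} (hr : r.IsRational) (k : ℕ) :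
    (soloInformedFlatIter r k).IsRational := by
  induction k with
  | zero => exact hr
  | succ k ih => exact soloInformed_isRational_flat ih

/-! ### Transport along an equality of dimensions -/

/-- Transport of a representation along `a = b` keeps KZ's literal shape. [folklore] -/
theorem soloInformed_isRational_cast {a b : ℕ} (h : a = b) (s : IntegralRep a) :
    (h ▸ s : IntegralRep b).IsRational ↔ s.IsRational := by
  subst h; exact Iff.rfl

/-- Transport of a representation along `a = b` keeps the value. [folklore] -/
theorem soloInformed_value_cast {a b : ℕ} (h : a = b) (s : IntegralRep a) :
    (h ▸ s : IntegralRep b).value = s.value := by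
  subst h; rfl

/-- Transport of a representation along `a = b` keeps the equivalence class. [folklore] -/
theorem soloInformed_equivalent_cast_iff {a b : ℕ} (h : a = b) (t : IntegralRep k)
    (s : IntegralRep a) : Equivalent t (h ▸ s : IntegralRep b) ↔ Equivalent t s := by
  subst h; exact Iff.rfl

/-! ### The equal-dimension reduction of the summit -/

/-- **Equal-dimension reduction of Conjecture 1 (unconditional)**: the Kontsevich–Zagier period
conjecture holds iff it holds for pairs of representations of the SAME dimension (flatten the two
representations to the common dimension `n + m`: values, literal shape and equivalence classes are
unchanged). [Kontsevich–Zagier 2001, §1.2, Conjecture 1; this work] -/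
theorem soloInformed_kzp_iff_sameDim :
    KontsevichZagierPeriods ↔
      ∀ (n : ℕ) (r r' : IntegralRep n), r.IsRational → r'.IsRational → r.value = r'.value →
        Equivalent r r' := by
  rw [KontsevichZagierPeriods_iff]
  refine ⟨fun h n r r' hr hr' hv => h r r' hr hr' hv, fun h n m r r' hr hr' hv => ?_⟩
  have e : m + n = n + m := Nat.add_comm m n
  have h1 : Equivalent (soloInformedFlatIter r m) (e ▸ soloInformedFlatIter r' n : IntegralRep (n + m)) :=
    h (n + m) _ _ (soloInformed_isRational_flatIter hr m)
      ((soloInformed_isRational_cast e _).mpr (soloInformed_isRational_flatIter hr' n))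
      (by rw [soloInformed_value_cast, soloInformed_value_flatIter, soloInformed_value_flatIter, hv])
  exact (soloInformed_equivalent_flatIter_iff r r' m n).mp
    ((soloInformed_equivalent_cast_iff e _ _).mp h1)

/-- Representations of different dimensions: `r ~ r'` iff `r × [0,1]^m ~ r' × [0,1]^n` transported to
the common dimension `n + m`. [this work] -/
theorem soloInformed_equivalent_iff_flatIter_common (r : IntegralRep n) (r' : IntegralRep m) :
    Equivalent r r' ↔
      Equivalent (soloInformedFlatIter r m)
        (Nat.add_comm m n ▸ soloInformedFlatIter r' n : IntegralRep (n + m)) := by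
  rw [soloInformed_equivalent_cast_iff, soloInformed_equivalent_flatIter_iff]

/-! ### The flat Kontsevich–Zagier conjecture -/

/-- **The flat Kontsevich–Zagier conjecture**: every formal `ℤ`-combination of integral
representations with value `0` lies in `relations₁₂ ⊔ U` — it is generated by additivity in the
domain and in the integrand, algebraic changes of variables, and the flattening differences
`[r × [0,1]] − [r]`; no Newton–Leibniz / Stokes move. [this work, THEOREM NF and COROLLARY NF.2] -/
def SoloInformedFlatKZConjecture : Prop :=
  ∀ c : FormalRep, eval c = 0 → c ∈ soloInformedEquidimRelations ⊔ soloInformedFlatSpan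

/-- The flat conjecture implies the kernel form of the period conjecture (`relations₁₂ ⊔ U ≤ relations`).
[this work] -/
theorem soloInformed_kzKernelConjecture_of_flatKZConjecture (h : SoloInformedFlatKZConjecture) :
    KZKernelConjecture := fun c hc =>
  soloInformed_equidimRelations_sup_flatSpan_le_relations (h c hc)

/-- The flat conjecture implies Newton–Leibniz elimination (a Newton–Leibniz move has value `0`
by soundness of the calculus). [this work] -/
theorem soloInformed_nlElimination_of_flatKZConjecture (h : SoloInformedFlatKZConjecture) :
    SoloInformedNLElimination := fun c hc =>
  h c (relations_le_ker_eval_holds (newtonLeibnizRel_subset_relations hc))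

/-- **`FlatKZ ↔ KZKernelConjecture ∧ NLElimination`** (unconditional). [this work, THEOREM NF] -/
theorem soloInformed_flatKZConjecture_iff :
    SoloInformedFlatKZConjecture ↔ KZKernelConjecture ∧ SoloInformedNLElimination := by
  refine ⟨fun h => ⟨soloInformed_kzKernelConjecture_of_flatKZConjecture h,
    soloInformed_nlElimination_of_flatKZConjecture h⟩, fun h c hc => ?_⟩
  rw [← soloInformed_relations_eq_sup_of_nlElimination h.2]
  exact h.1 c hc

/-- **`FlatKZ ↔ KontsevichZagierPeriods ∧ NLElimination`** (unconditional; the summit in kernel form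
is `KZKernelConjecture`, `kzKernelConjecture_iff_isRational`). [Kontsevich–Zagier 2001, §1.2,
Conjecture 1; this work, THEOREM NF] -/
theorem soloInformed_flatKZConjecture_iff_summit :
    SoloInformedFlatKZConjecture ↔ KontsevichZagierPeriods ∧ SoloInformedNLElimination := by
  rw [soloInformed_flatKZConjecture_iff, KontsevichZagierPeriods_iff, kzKernelConjecture_iff_isRational]

/-- The flat conjecture implies the summit. [this work] -/
theorem soloInformed_summit_of_flatKZConjecture (h : SoloInformedFlatKZConjecture) :
    KontsevichZagierPeriods :=
  (soloInformed_flatKZConjecture_iff_summit.mp h).1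

/-- **The flat conjecture in stable form (unconditional)**: by the torsion theorem
(`soloInformed_mem_sup_iff_totalFlat`), `FlatKZ` says that a null formal combination, totally
flattened to any large dimension `N`, is an equidimensional relation. [this work, THEOREM NF] -/
theorem soloInformed_flatKZConjecture_iff_totalFlat :
    SoloInformedFlatKZConjecture ↔
      ∀ c : FormalRep, eval c = 0 →
        ∃ M, ∀ N, M ≤ N → soloInformedTotalFlat N c ∈ soloInformedEquidimRelations := by
  refine forall_congr' fun c => imp_congr_right fun _ => ?_
  exact soloInformed_mem_sup_iff_totalFlat c

/-- **Granting THEOREM NF, the summit IS the flat conjecture.** [this work, THEOREM NF] -/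
theorem soloInformed_summit_iff_flatKZConjecture_of_nlElimination (h : SoloInformedNLElimination) :
    KontsevichZagierPeriods ↔ SoloInformedFlatKZConjecture := by
  rw [soloInformed_flatKZConjecture_iff_summit]
  exact ⟨fun hK => ⟨hK, h⟩, fun hK => hK.1⟩

/-- **Granting THEOREM NF, the summit in stable equidimensional form**: `KontsevichZagierPeriods ↔`
every null formal combination `c` has `Φ_N c ∈ relations₁₂` for all large `N` — the
representation-level form of "KZP ⟺ the STABLE generalised Hilbert-third-problem statement for
finite-volume `ℚ`-semialgebraic sets" (`paper/VERDICT.md` §1). [this work, COROLLARY NF.2] -/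
theorem soloInformed_summit_iff_totalFlat_of_nlElimination (h : SoloInformedNLElimination) :
    KontsevichZagierPeriods ↔
      ∀ c : FormalRep, eval c = 0 →
        ∃ M, ∀ N, M ≤ N → soloInformedTotalFlat N c ∈ soloInformedEquidimRelations :=
  (soloInformed_summit_iff_flatKZConjecture_of_nlElimination h).trans
    soloInformed_flatKZConjecture_iff_totalFlat

/-- **Granting THEOREM NF, the summit for pairs**: `KontsevichZagierPeriods ↔` any two
representations of the same dimension, of KZ's literal shape and with the same value, become
connected by equidimensional moves alone after finitely many flattenings `× [0,1]`.
[Kontsevich–Zagier 2001, §1.2, Conjecture 1; this work, COROLLARY NF.1] -/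
theorem soloInformed_summit_iff_sameDim_flatIter_of_nlElimination (h : SoloInformedNLElimination) :
    KontsevichZagierPeriods ↔
      ∀ (n : ℕ) (r r' : IntegralRep n), r.IsRational → r'.IsRational → r.value = r'.value →
        ∃ k, of (soloInformedFlatIter r k) - of (soloInformedFlatIter r' k) ∈
          soloInformedEquidimRelations := by
  rw [soloInformed_kzp_iff_sameDim]
  refine forall_congr' fun n => forall_congr' fun r => forall_congr' fun r' =>
    imp_congr_right fun _ => imp_congr_right fun _ => imp_congr_right fun _ => ?_
  exact soloInformed_equivalent_iff_exists_flatIter_of_nlElimination h r r'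

end Summit.KontsevichZagierPeriods.KontsevichZagierPeriods.Theorems
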